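import Summits.ResolutionOfSingularities.ResolutionOfSingularities.Theorems.HilbertSamuelEliminationSigmaMaxModificationsCorridor3WLadderIsoTailsArcLimitFlat
import Literature.RingTheory.HilbertSamuel.BennettRegularCentreDim
import Mathlib.RingTheory.Localization.Ideal
import Mathlib.RingTheory.Localization.AtPrime.Basic
import HarnessLib

/-!
# [OURS · L1 W4.2 · D14 ROUTE G v2 «ARC LIMIT» · G2c, file 6] Bennett's equality along the arc from nearness (assembly)

Sub-problem `ResolutionOfSingularities`, crux `SigmaMaxModifications` / conjunct `SigmaMaxModificationsCorridor3`
(route `HilbertSamuelElimination`, line `w_ladder`), idea chain L1 C5 «K1 FREE-RATIONAL TAILS», ROUTE G v2 (memo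
`L/res-L1-w42-lead-1/ROUTE-G-ARCLIMIT.md` 96c77a196e17bc23), over `…IsoTailsArcLimitFlat` + `…ArcLimitInclusion`.

* §1 the localisation `L = S_{P₀}` and its quotients `L / 𝔞L` as localisations of `S/𝔞` at `P₀/𝔞` (`𝔞 ≤ P₀`);
* §2 **`J` and `J_∞` have the same `P₀`-initial ideals after inverting `t`** ⇒ `H^{(0)}[L/JL] = H^{(0)}[L/J_∞L]`;
* §3 **`hilbertSamuelFun_arcLimit`** — THE G2c TARGET (interface STATUS 12:44:11Z): for the tower `Jn` of `t`-saturated ideals of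
  `S = K⟦t, y_1..y_d⟧` containing the scalings of `J = Jn 0 ⊆ P₀` and all with the Hilbert function of `S/J` (nearness along a
  free-rational tail, in sheared formal coordinates), Bennett's EQUALITY `H^{(1)}[(S/J)_{P₀}] = H^{(0)}[S/J]` holds — the `hH` of
  res-type-001's `IsoTailsHS.not_isIsolatedInHSMaxLocus_closedPoint_of_hilbertSamuelFun_eq` (p528484); chain:
  `H⁰[S/J] ≤ H⁰[S/J_∞]` (file 4) `= H¹[(S/J_∞)_𝔓]` (file 5) `= H¹[(S/J)_𝔓]` (§2) `≤ H⁰[S/J]` (tree Bennett, HIO 30.1).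
* `le_arcIdeal_of_tower` — `J ⊆ P₀` is itself forced by the tower (a unit in `J_∞` would make a late `Jn n` trivial).

Everything is OURS; no statement of the manuscript under adjudication and no published theorem is asserted.
[cite: HerrmannIkedaOrbanz1988, Prop. (30.1), Thm. (22.24)] [cite: CossartJannsenSaito2020, Thm. 3.3, Lemma 2.24]
-/

set_option linter.dupNamespace false -- mandated namespace of this single-conjunct summit
open MvPowerSeries IsLocalRing
open Finsupp hiding some
open Literature.RingTheory.HilbertSamuel Literature.AlgebraicGeometry.Resolution

noncomputable section

universe u

namespace Summit.ResolutionOfSingularities.ResolutionOfSingularities.Cruxes.SigmaMaxModifications.IdeasL1C5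

namespace ArcLimit

variable {d : ℕ} {K : Type u} [Field K]

/-! ### §1. Localising at the arc -/

section Loc

variable [hP : (arcIdeal d K).IsPrime] (𝔞 : Ideal (MvPowerSeries (Fin (d + 1)) K)) (h𝔞 : 𝔞 ≤ arcIdeal d K)

include h𝔞 in
/-- The image of `P₀.primeCompl` in `S/𝔞` is the complement of `P₀/𝔞` (`𝔞 ≤ P₀`). [folklore] -/
theorem algebraMapSubmonoid_primeCompl_eq [hq : ((arcIdeal d K).map (Ideal.Quotient.mk 𝔞)).IsPrime] :
    Algebra.algebraMapSubmonoid (MvPowerSeries (Fin (d + 1)) K ⧸ 𝔞) (arcIdeal d K).primeCompl =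
      ((arcIdeal d K).map (Ideal.Quotient.mk 𝔞)).primeCompl := by
  ext x
  constructor
  · rintro ⟨y, hy, rfl⟩ hx
    exact hy ((Ideal.mem_quotient_iff_mem h𝔞).mp hx)
  · intro hx
    obtain ⟨y, rfl⟩ := Ideal.Quotient.mk_surjective x
    exact ⟨y, fun hy => hx (Ideal.mem_map_of_mem _ hy), rfl⟩

include h𝔞 in
/-- `L/𝔞L` is a localisation of `S/𝔞` at `P₀/𝔞`. [folklore] -/
theorem isLocalizationAtPrime_quotient [hq : ((arcIdeal d K).map (Ideal.Quotient.mk 𝔞)).IsPrime] :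
    IsLocalization.AtPrime (Localization.AtPrime (arcIdeal d K) ⧸
      𝔞.map (algebraMap _ (Localization.AtPrime (arcIdeal d K)))) ((arcIdeal d K).map (Ideal.Quotient.mk 𝔞)) := by
  show IsLocalization _ _
  rw [← algebraMapSubmonoid_primeCompl_eq 𝔞 h𝔞]
  infer_instance

include h𝔞 in
/-- `𝔞L ≠ L`, so `L/𝔞L` is a local ring. [folklore] -/
theorem isLocalRing_loc_quotient :
    IsLocalRing (Localization.AtPrime (arcIdeal d K) ⧸ 𝔞.map (algebraMap _ (Localization.AtPrime (arcIdeal d K)))) := by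
  have hne : 𝔞.map (algebraMap _ (Localization.AtPrime (arcIdeal d K))) ≠ ⊤ := by
    intro h
    have hle : 𝔞.map (algebraMap _ (Localization.AtPrime (arcIdeal d K))) ≤
        maximalIdeal (Localization.AtPrime (arcIdeal d K)) := by
      rw [← Localization.AtPrime.map_eq_maximalIdeal]; exact Ideal.map_mono h𝔞
    exact (maximalIdeal.isMaximal _).ne_top (top_le_iff.mp (h ▸ hle))
  haveI : Nontrivial (Localization.AtPrime (arcIdeal d K) ⧸ 𝔞.map (algebraMap _ (Localization.AtPrime (arcIdeal d K)))) :=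
    Ideal.Quotient.nontrivial_iff.mpr hne
  exact IsLocalRing.of_surjective' (Ideal.Quotient.mk _) Ideal.Quotient.mk_surjective

/-- Powers of the maximal ideal of `L = S_{P₀}`. [folklore] -/
theorem maximalIdeal_loc_pow (s : ℕ) :
    maximalIdeal (Localization.AtPrime (arcIdeal d K)) ^ s =
      (arcIdeal d K ^ s).map (algebraMap _ (Localization.AtPrime (arcIdeal d K))) := by
  rw [Ideal.map_pow, Localization.AtPrime.map_eq_maximalIdeal]

/-- `t` is a unit in `L = S_{P₀}`. [folklore] -/
theorem isUnit_algebraMap_X_zero_pow (k : ℕ) :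
    IsUnit (algebraMap (MvPowerSeries (Fin (d + 1)) K) (Localization.AtPrime (arcIdeal d K)) (X 0 ^ k)) := by
  rw [map_pow]
  exact (IsLocalization.map_units (Localization.AtPrime (arcIdeal d K))
    ⟨X 0, show (X 0 : MvPowerSeries (Fin (d + 1)) K) ∈ (arcIdeal d K).primeCompl from X_zero_not_mem_arcIdeal⟩).pow k

end Loc

/-! ### §2. `J` and `J_∞` have the same initial ideals along `P₀` after inverting `t` -/

/-- `(J ∩ P₀^s) + P₀^{s+1} ⊆ (J_∞ ∩ P₀^s) + P₀^{s+1}` (already in `S`). [folklore] -/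
theorem inf_pow_sup_le_limit (J : Ideal (MvPowerSeries (Fin (d + 1)) K)) (s : ℕ) :
    (J ⊓ arcIdeal d K ^ s) ⊔ arcIdeal d K ^ (s + 1) ≤ (limitIdeal J ⊓ arcIdeal d K ^ s) ⊔ arcIdeal d K ^ (s + 1) := by
  refine sup_le ?_ le_sup_right
  rintro g ⟨hgJ, hgP⟩
  have : g = layer s g + (g - layer s g) := by ring
  rw [this]
  exact Submodule.add_mem_sup ⟨layer_mem_limitIdeal hgJ hgP, layer_mem_arcIdeal_pow s g⟩ (sub_layer_mem_arcIdeal_pow_succ hgP)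

/-- After localising at `P₀` the two initial ideals agree. [folklore] -/
theorem map_inf_pow_sup_eq [hP : (arcIdeal d K).IsPrime] (J : Ideal (MvPowerSeries (Fin (d + 1)) K)) (s : ℕ) :
    ((J ⊓ arcIdeal d K ^ s) ⊔ arcIdeal d K ^ (s + 1)).map (algebraMap _ (Localization.AtPrime (arcIdeal d K))) =
      ((limitIdeal J ⊓ arcIdeal d K ^ s) ⊔ arcIdeal d K ^ (s + 1)).map
        (algebraMap _ (Localization.AtPrime (arcIdeal d K))) := by
  refine le_antisymm (Ideal.map_mono (inf_pow_sup_le_limit J s)) ?_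
  rw [Ideal.map_le_iff_le_comap]
  refine sup_le ?_ ?_
  · rintro h ⟨hh, hhP⟩
    obtain ⟨k, hk⟩ := exists_X_pow_mul_mem_of_mem_limitIdeal hh hhP
    rw [Ideal.mem_comap]
    have hmem := Ideal.mem_map_of_mem (algebraMap _ (Localization.AtPrime (arcIdeal d K))) hk
    rw [map_mul] at hmem
    obtain ⟨u, hu⟩ := isUnit_algebraMap_X_zero_pow (d := d) (K := K) k
    rw [← hu] at hmem
    have := Ideal.mul_mem_left _ (↑u⁻¹ : Localization.AtPrime (arcIdeal d K)) hmem
    rwa [← mul_assoc, Units.inv_mul, one_mul] at this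
  · intro r hr
    exact Ideal.mem_comap.mpr (Ideal.mem_map_of_mem _ (Submodule.mem_sup_right hr))

set_option maxHeartbeats 1600000 in
/-- **`H^{(0)}[L/JL] = H^{(0)}[L/J_∞L]`.** [cite: CossartJannsenSaito2020, Lemma 2.24 (device)] -/
theorem hilbertFun_loc_quotient_eq [hP : (arcIdeal d K).IsPrime] (J : Ideal (MvPowerSeries (Fin (d + 1)) K))
    [IsLocalRing (Localization.AtPrime (arcIdeal d K) ⧸ J.map (algebraMap _ (Localization.AtPrime (arcIdeal d K))))]
    [IsLocalRing (Localization.AtPrime (arcIdeal d K) ⧸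
      (limitIdeal J).map (algebraMap _ (Localization.AtPrime (arcIdeal d K))))] :
    hilbertFun (Localization.AtPrime (arcIdeal d K) ⧸ J.map (algebraMap _ (Localization.AtPrime (arcIdeal d K)))) =
      hilbertFun (Localization.AtPrime (arcIdeal d K) ⧸
        (limitIdeal J).map (algebraMap _ (Localization.AtPrime (arcIdeal d K)))) := by
  haveI : IsNoetherianRing (MvPowerSeries (Fin (d + 1)) K) := isNoetherianRing_mvPowerSeries K (Fin (d + 1))
  haveI : IsNoetherianRing (Localization.AtPrime (arcIdeal d K)) :=
    IsLocalization.isNoetherianRing (arcIdeal d K).primeCompl _ inferInstance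
  funext s
  refine hilbertFun_eq_of_ker_inf_pow_sup_eq (A := Localization.AtPrime (arcIdeal d K))
    Ideal.Quotient.mk_surjective Ideal.Quotient.mk_surjective s ?_
  have hk1 : RingHom.ker (algebraMap (Localization.AtPrime (arcIdeal d K))
      (Localization.AtPrime (arcIdeal d K) ⧸ J.map (algebraMap _ (Localization.AtPrime (arcIdeal d K))))) =
      J.map (algebraMap _ (Localization.AtPrime (arcIdeal d K))) := by
    rw [Ideal.Quotient.algebraMap_eq, Ideal.mk_ker]
  have hk2 : RingHom.ker (algebraMap (Localization.AtPrime (arcIdeal d K))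
      (Localization.AtPrime (arcIdeal d K) ⧸ (limitIdeal J).map (algebraMap _ (Localization.AtPrime (arcIdeal d K))))) =
      (limitIdeal J).map (algebraMap _ (Localization.AtPrime (arcIdeal d K))) := by
    rw [Ideal.Quotient.algebraMap_eq, Ideal.mk_ker]
  rw [hk1, hk2, maximalIdeal_loc_pow, maximalIdeal_loc_pow,
    ← IsLocalization.map_inf (arcIdeal d K).primeCompl (Localization.AtPrime (arcIdeal d K)),
    ← IsLocalization.map_inf (arcIdeal d K).primeCompl (Localization.AtPrime (arcIdeal d K)),
    ← Ideal.map_sup, ← Ideal.map_sup, map_inf_pow_sup_eq]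

/-! ### §3. The target -/

/-- `J ⊆ P₀` is forced by the tower: a `y`-free unit in `J_∞` would make a late `Jn n` the unit ideal. [folklore] -/
theorem le_arcIdeal_of_tower {Jn : ℕ → Ideal (MvPowerSeries (Fin (d + 1)) K)}
    (hsat : ∀ n f, X 0 * f ∈ Jn n → f ∈ Jn n) (hscale : ∀ n g, g ∈ Jn 0 → subst (scale d K n) g ∈ Jn n)
    [hloc : ∀ n, IsLocalRing (MvPowerSeries (Fin (d + 1)) K ⧸ Jn n)] : Jn 0 ≤ arcIdeal d K := by
  haveI : IsNoetherianRing (MvPowerSeries (Fin (d + 1)) K) := isNoetherianRing_mvPowerSeries K (Fin (d + 1))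
  intro g hg
  by_contra hgP
  obtain ⟨k, v, hvu, hv0, hkv⟩ := exists_layer_zero_eq_X_pow_mul_unit hgP
  -- `v ∈ satLayer (Jn 0) 0 ⊆ J_∞`
  have hv : v ∈ satLayer (Jn 0) 0 :=
    ⟨hv0, k, by rw [← hkv]; exact layer_mem_layerSub hg (by simp)⟩
  have hvJ : v ∈ limitIdeal (Jn 0) := mem_limitIdeal_of_mem_satLayer hv
  obtain ⟨k₀, hk₀⟩ := exists_limitIdeal_le_sup_span_X_pow (Jn 0) hsat hscale
  have hmem := hk₀ (k₀ + 1) (by omega) hvJ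
  rw [show k₀ + 1 - k₀ = 1 by omega, pow_one] at hmem
  -- but `Jn (k₀+1) + (t) ⊆ 𝔪`, which contains no unit
  haveI := hloc (k₀ + 1)
  have hne : Jn (k₀ + 1) ≠ ⊤ := fun h => by
    have : Subsingleton (MvPowerSeries (Fin (d + 1)) K ⧸ Jn (k₀ + 1)) :=
      Ideal.Quotient.subsingleton_iff.mpr h
    exact false_of_nontrivial_of_subsingleton (MvPowerSeries (Fin (d + 1)) K ⧸ Jn (k₀ + 1))
  have hle : Jn (k₀ + 1) ⊔ Ideal.span {X 0} ≤ maximalIdeal (MvPowerSeries (Fin (d + 1)) K) :=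
    sup_le (IsLocalRing.le_maximalIdeal hne) ((Ideal.span_singleton_le_iff_mem _).mpr X_zero_mem_maximalIdeal)
  exact (IsLocalRing.mem_maximalIdeal _).mp (hle hmem) hvu

/-- **[OURS · L1 W4.2 · ROUTE G v2] BENNETT'S EQUALITY ALONG THE ARC FROM NEARNESS — the G2c target.** Let `Jn` be a tower of
`t`-saturated ideals of `S = K⟦t, y_1..y_d⟧` containing the scalings `y ↦ tⁿy` of `J = Jn 0`, all with the Hilbert function of `S/J`
(the formal strict transforms of an isolated free-rational tail, in sheared coordinates, read in the common frame). Then for the arc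
prime `𝔓 = P₀/J` of `A = S/J`:  `H^{(1)}[A_𝔓] = H^{(0)}[A]` — so `A` is normally flat along the arc (tree Thm. 3.3) and, by
res-type-001's landed end, the closed point of `Spec A` is NOT isolated in its Hilbert–Samuel locus.
[cite: HerrmannIkedaOrbanz1988, Prop. (30.1), Thm. (22.24)] [cite: CossartJannsenSaito2020, Thm. 3.3] -/
theorem hilbertSamuelFun_arcLimit {Jn : ℕ → Ideal (MvPowerSeries (Fin (d + 1)) K)}
    (hsat : ∀ n f, X 0 * f ∈ Jn n → f ∈ Jn n) (hscale : ∀ n g, g ∈ Jn 0 → subst (scale d K n) g ∈ Jn n)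
    [hloc : ∀ n, IsLocalRing (MvPowerSeries (Fin (d + 1)) K ⧸ Jn n)]
    (hHS : ∀ n, hilbertFun (MvPowerSeries (Fin (d + 1)) K ⧸ Jn n) = hilbertFun (MvPowerSeries (Fin (d + 1)) K ⧸ Jn 0))
    [hPJ : ((arcIdeal d K).map (Ideal.Quotient.mk (Jn 0))).IsPrime] :
    hilbertSamuelFun (Localization.AtPrime ((arcIdeal d K).map (Ideal.Quotient.mk (Jn 0)))) 1 =
      hilbertFun (MvPowerSeries (Fin (d + 1)) K ⧸ Jn 0) := by
  set S := MvPowerSeries (Fin (d + 1)) K with hS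
  set J := Jn 0 with hJdef
  have hJ : J ≤ arcIdeal d K := le_arcIdeal_of_tower hsat hscale
  haveI : IsNoetherianRing S := isNoetherianRing_mvPowerSeries K (Fin (d + 1))
  haveI : (arcIdeal d K).IsPrime := isPrime_arcIdeal
  haveI := hloc 0
  haveI : IsLocalRing (S ⧸ limitIdeal J) := isLocalRing_limit J hJ
  haveI : (limitPrime J).IsPrime := isPrime_limitPrime J hJ
  -- the two localised quotients
  set L := Localization.AtPrime (arcIdeal d K) with hL
  haveI := isLocalRing_loc_quotient (d := d) (K := K) J hJ
  haveI := isLocalRing_loc_quotient (d := d) (K := K) (limitIdeal J) (limitIdeal_le J hJ)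
  haveI := isLocalizationAtPrime_quotient (d := d) (K := K) J hJ
  haveI hlocinf := isLocalizationAtPrime_quotient (d := d) (K := K) (limitIdeal J) (limitIdeal_le J hJ)
  -- (1) file 4: `H⁰[S/J] ≤ H⁰[S/J_∞]`
  have h1 : ∀ s, hilbertFun (S ⧸ J) s ≤ hilbertFun (S ⧸ limitIdeal J) s :=
    hilbertFun_le_hilbertFun_limitIdeal hsat hscale hHS
  -- (2) file 5: `H⁰[S/J_∞] = H¹[L/J_∞L]`
  have h2 : hilbertFun (S ⧸ limitIdeal J) =
      hilbertSamuelFun (L ⧸ (limitIdeal J).map (algebraMap S L)) 1 :=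
    hilbertFun_limit_eq_hilbertSamuelFun J hJ (L ⧸ (limitIdeal J).map (algebraMap S L))
  -- (3) §2: `H⁰[L/J_∞L] = H⁰[L/JL]`, hence the same `H¹`
  have h3 : hilbertSamuelFun (L ⧸ (limitIdeal J).map (algebraMap S L)) 1 =
      hilbertSamuelFun (L ⧸ J.map (algebraMap S L)) 1 := by
    simp only [hilbertSamuelFun]
    rw [hilbertFun_loc_quotient_eq J]
  -- (4) tree Bennett: `H¹[L/JL] ≤ H⁰[S/J]` (the centre `P₀/J` is regular of dimension one)
  haveI : IsRegularLocalRing ((S ⧸ J) ⧸ (arcIdeal d K).map (Ideal.Quotient.mk J)) :=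
    haveI := isRegularLocalRing_quotient_arcIdeal (d := d) (K := K)
    IsRegularLocalRing.of_ringEquiv (DoubleQuot.quotQuotEquivQuotOfLE hJ).symm
  have hdim : ringKrullDim ((S ⧸ J) ⧸ (arcIdeal d K).map (Ideal.Quotient.mk J)) = (1 : ℕ) := by
    rw [ringKrullDim_eq_of_ringEquiv (DoubleQuot.quotQuotEquivQuotOfLE hJ), ringKrullDim_quotient_arcIdeal]; rfl
  have h4 : hilbertSamuelFun (L ⧸ J.map (algebraMap S L)) 1 ≤ hilbertFun (S ⧸ J) :=
    hilbertSamuelFun_le_hilbertFun_of_isRegularLocalRing_quotient 1 _ (L ⧸ J.map (algebraMap S L)) hdim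
  -- squeeze
  have heq : hilbertSamuelFun (L ⧸ J.map (algebraMap S L)) 1 = hilbertFun (S ⧸ J) := by
    funext s
    refine le_antisymm (h4 s) ?_
    calc hilbertFun (S ⧸ J) s ≤ hilbertFun (S ⧸ limitIdeal J) s := h1 s
      _ = hilbertSamuelFun (L ⧸ J.map (algebraMap S L)) 1 s := by rw [h2, h3]
  -- transport to the canonical localisation
  rw [← heq]
  simp only [hilbertSamuelFun]
  congr 1
  exact hilbertFun_eq_of_isLocalization_atPrime _ (L ⧸ J.map (algebraMap S L))

end ArcLimit

end Summit.ResolutionOfSingularities.ResolutionOfSingularities.Cruxes.SigmaMaxModifications.IdeasL1C5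

end
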